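import Summits.HodgeConjecture.HodgeConjecture.Theorems.TropicalKugaSatakeCayleyKontsevichTransferKSFlatWeight
import Summits.HodgeConjecture.HodgeConjecture.Theorems.TropicalKugaSatakeCayleyKontsevichTransferKSWeightZeroForms
import Mathlib

/-!
# Route `TropicalKugaSatakeCayley`, crux K2 `KontsevichTransferKS` (stmt-HodgeConjecture-18570), line `birth`:
# STUB 2 `stub_noWeightDrop` — NO WEIGHT DROP — proved

The registered stub (risk R2 of the route) reads `∀ ω ∈ flatHodgeForms, tropProj ω = 0 → ω = 0`: a
constant complex `12`-form `ω` on `Λ_ℝ = ℝ⁸_x ⊕ ℝ⁸_y` in the `ℂ`-span of the flat Hodge forms (type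
`(6,6)` on every member of the Kuga–Satake family through every Kuga–Satake period map) whose tropical
`(6,6)`-block vanishes is zero. The skeleton's `flatHodgeForms`, `tropProj`, `latticeTuple`, `coSub` are
file-local to `Cruxes/KontsevichTransferKS/Lines/birth.lean`, so the statement is given here with them
UNFOLDED (`kontsevichTransferKS_noWeightDrop`); the registered signature follows by
`fun ω hω h0 => kontsevichTransferKS_noWeightDrop ω hω (fun I J => congrFun (congrFun h0 I) J)`
(kernel-checked against verbatim copies of the skeleton's definitions before submission).

Proof: the weight-zero property `D_H ω = 0` of part 1 (`ktks_flat_sum_update_weight`, from the two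
diagonal members `i B₁`, `2i B₁` and `[J_1, J_2] = (3/2) H`) is linear in `ω`, hence holds on the span;
part 2 (`ktks_eq_zero_of_weight_of_trop`) concludes. No definition, no named fact, no sorry.

## References

* [vanGeemenVerra2003QuaternionicPryms] B. van Geemen, A. Verra, Quaternionic Pryms and Hodge classes,
  Topology 42 (2003), §6.1, Rem. 6.6.
* [MikhalkinZharkov2014Eigenwave] G. Mikhalkin, I. Zharkov, Tropical eigenwave and intermediate
  Jacobians (2014), §6.2.
-/

noncomputable section

set_option linter.dupNamespace false

namespace Summit.HodgeConjecture.HodgeConjecture.Theorems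

open Literature.AlgebraicGeometry.Tropical Literature.AlgebraicGeometry.Tropical.TropicalTorus
open Literature.Geometry.Kaehler

/-! ### §5 The stub -/

/-- **STUB 2 `stub_noWeightDrop` of line `birth` of crux K2 `KontsevichTransferKS`
(stmt-HodgeConjecture-18570), with the skeleton-local definitions unfolded** (`flatHodgeForms` = the
`ℂ`-span of the constant `12`-forms on `ℝ⁸ ⊕ ℝ⁸` of type `(6,6)` along every Kuga–Satake period map of
every member of the family; `tropProj ω I J = ω (latticeTuple I J)`, the block of monomials with six
`f*` and six `e*`): **a flat Hodge form whose tropical `(6,6)`-block vanishes is zero.** Proof: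
flatness at the two diagonal members `z = i B₁`, `2i B₁` differentiates to `D_{J_1} ω = D_{J_2} ω = 0`
(§1, §3); `[J_1, J_2] = (3/2) H` with `H(x, y) = (x, -y)` the weight operator of the cusp, so
`D_H ω = 0` (the form has `gr^W`-weight zero); hence `ω` vanishes on every tuple of lattice basis
vectors with unequal numbers of `x`- and `y`-vectors, and the balanced tuples are permutations of the
tuples read by the tropical block (§4). The registered stub follows by
`fun ω hω h0 => kontsevichTransferKS_noWeightDrop ω hω (fun I J => congrFun (congrFun h0 I) J)` up to
unfolding. [cite: vanGeemenVerra2003QuaternionicPryms, §6.1 and Rem. 6.6]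
[cite: MikhalkinZharkov2014Eigenwave, §6.2] -/
theorem kontsevichTransferKS_noWeightDrop (ω : (Fin 8 ⊕ Fin 8 → ℝ) [⋀^Fin (2 * 6)]→L[ℝ] ℂ)
    (hω : ω ∈ Submodule.span ℂ
      {η : (Fin 8 ⊕ Fin 8 → ℝ) [⋀^Fin (2 * 6)]→L[ℝ] ℂ |
        ∀ z : Fin 5 → ℂ, (fun i => (z i).im) ∈ ksPosCone →
          ∀ Φ : (Fin 8 ⊕ Fin 8 → ℝ) ≃L[ℝ] (Fin 8 → ℂ), IsKSPeriodMap z Φ →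
            ComplexTorus.IsConstOfType 6 6
              (η.compContinuousLinearMap (Φ.symm : (Fin 8 → ℂ) →L[ℝ] (Fin 8 ⊕ Fin 8 → ℝ)))})
    (htrop : ∀ I J : Sub 8 2,
      ω (Fin.append (m := 6) (n := 6)
        (fun k => (Pi.single (Sum.inr ((Finset.univ \ I.1).orderEmbOfFin (ktks_card_compl I) k)) (1 : ℝ) :
          Fin 8 ⊕ Fin 8 → ℝ))
        (fun k => (Pi.single (Sum.inl ((Finset.univ \ J.1).orderEmbOfFin (ktks_card_compl J) k)) (1 : ℝ) :
          Fin 8 ⊕ Fin 8 → ℝ))) = 0) :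
    ω = 0 := by
  refine ktks_eq_zero_of_weight_of_trop ω ?_ htrop
  clear htrop
  induction hω using Submodule.span_induction with
  | mem x hx => exact ktks_flat_sum_update_weight x hx
  | zero => intro w; simp
  | add x y _ _ hx hy =>
      intro w
      simp only [ContinuousAlternatingMap.add_apply, Finset.sum_add_distrib, hx w, hy w, add_zero]
  | smul a x _ hx =>
      intro w
      simp only [ContinuousAlternatingMap.smul_apply, ← Finset.smul_sum, hx w, smul_zero]

end Summit.HodgeConjecture.HodgeConjecture.Theorems

end
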